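import Summits.QuantumFields.YangMills.Theorems.ColdStartUniversalityLatticeLangevinHypercontractiveDecorrelation
import Summits.QuantumFields.YangMills.Theorems.ColdStartUniversalityLatticeLangevinDiscreteSampling
import HarnessLib

/-!
# Route `ColdStartUniversality` (fixed-cut-off package, `Lᵖ` side): ★★★ VOLUME-FREE MEAN-SQUARE ERGODIC THEOREM AND DEVIATION BOUND FOR
# DISCRETE SAMPLES of ALL bounded observables after the `O(log L)` hypercontractive burn-in, `|β'| < 1/12`

Helper file (seat `ym-line-csu-p1`, g36; `--supports stmt-QuantumFields-24809`).  What a simulation records are equally spaced samples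
`U_{a₀}, U_{a₀+h}, U_{a₀+2h}, …` of ONE run after a burn-in `a₀`.  g33's discrete ergodic theorem (`integral_sq_average_sub_wilson_le`) has
Harris constants `C, c` depending on the volume.  With the volume-free two-time decorrelation after the hypercontractive burn-in
(`abs_twoTime_centered_le_exp_uniform`, g36: prefactor `e`, rate `λ = 1 − 12|β'|`, burn-in `a₀ = 2 + t₀`, `log B ≤ 2(1−12|β'|)t₀`,
`B = 96|β'|#E + 10|β'|#𝒫 + log 2 + #E·log(3/2) = O(L³)`) and g33's generic variance lemma `integral_sq_sum_le_of_twoTime`: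
* ★★★ `integral_sq_average_sub_wilson_le_uniform` — for every solution from a deterministic start, every bounded measurable `|G| ≤ 1`, every
  step `h > 0` and `N ≥ 1`:  `E[(N⁻¹Σ_{k<N} G(U_{2+t₀+kh}) − μ_{β'}G)²] ≤ (4 + 8e·e^{−λh}/(1 − e^{−λh}))/N` — INDEPENDENT OF `L`;
* ★★ `measureReal_average_deviation_le_uniform` — Chebyshev: `P[|N⁻¹Σ_{k<N} G(U_{2+t₀+kh}) − μG| ≥ ε] ≤ (4 + 8e·e^{−λh}/(1 − e^{−λh}))/(Nε²)`,
  i.e. the volume-free SAMPLE COMPLEXITY `N ≥ (4 + 8e/(e^{λh} − 1))/(δε²)` after `O(log L)` burn-in sweeps.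

THEOREMS ONLY, no definition, no sorry.  HONEST FRAMING: RECORD-rung R3 plumbing at FIXED cut-off in LATTICE units, high-temperature window
`|β'| < 1/12` only; nothing K-uniform; no crux, rung or summit statement is proved; the Yang–Mills mass gap is NOT proved.
-/

set_option autoImplicit false

noncomputable section

namespace Summit.QuantumFields.YangMills.Theorems.ColdStartUniversality

open MeasureTheory ProbabilityTheory Filter Set Topology
open scoped BigOperators NNReal ENNReal
open Literature.Probability.Process Literature.MathematicalPhysics.QuantumFieldTheory
open Literature.MathematicalPhysics.QuantumLattice (fundamentalRep fundamentalLatticeRep continuous_fundamentalRep)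

variable {L : ℕ} [NeZero L]

/-- ★★★ **Volume-free mean-square ergodic theorem for discrete samples after the burn-in.**  For every `L`, `|β'| < 1/12`, every
deterministic start `z`, EVERY strong solution `U` from `z` on ANY filtered probability space, every bounded measurable `G` with `|G| ≤ 1`,
every sampling step `h > 0`, every `N ≥ 1` and every `t₀` with `log B ≤ 2(1 − 12|β'|)t₀`:

  `E[(N⁻¹ Σ_{k<N} G(U_{2+t₀+kh}) − ∫ G dμ_{β'})²] ≤ (4 + 8e·e^{−(1−12|β'|)h}/(1 − e^{−(1−12|β'|)h}))/N`.

[cite: DiaconisSaloffcoste1996, Theorem 3.7] [cite: ShenZhuZhu2022, Corollary 4.4] -/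
theorem integral_sq_average_sub_wilson_le_uniform (L : ℕ) [NeZero L] (β' : ℝ) (hβ : |β'| < 1 / 12)
    (z : GaugeConfig 3 L (Matrix.specialUnitaryGroup (Fin 2) ℂ))
    {Ω : Type} [MeasurableSpace Ω] {P : Measure Ω} [IsProbabilityMeasure P]
    {W : ℝ≥0 → Ω → (Edge 3 L × NoiseIdx 2 → ℝ)} (hW : IsFlatBrownian W P)
    {U : ℝ≥0 → Ω → GaugeConfig 3 L (Matrix.specialUnitaryGroup (Fin 2) ℂ)} (hU0 : ∀ ω, U 0 ω = z)
    (hU : (latticeLangevinDynamics (fundamentalLatticeRep 2) β').IsSolution (fundamentalRep (Fin 2)) hW.natFiltration P W U)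
    {G : GaugeConfig 3 L (Matrix.specialUnitaryGroup (Fin 2) ℂ) → ℝ} (hG : Measurable G) (hG1 : ∀ x, |G x| ≤ 1)
    {h : ℝ≥0} (hh : 0 < h) {N : ℕ} (hN : 1 ≤ N) (t₀ : ℝ≥0)
    (ht₀ : Real.log (96 * |β'| * (Fintype.card (Edge 3 L) : ℝ) + 10 * |β'| * (Fintype.card (Plaquette 3 L) : ℝ) + Real.log 2 +
      (Fintype.card (Edge 3 L) : ℝ) * Real.log (3 / 2)) ≤ 2 * (1 - 12 * |β'|) * t₀) :
    ∫ ω, ((N : ℝ)⁻¹ * (∑ k ∈ Finset.range N, G (U (2 + t₀ + (k : ℝ≥0) * h) ω)) -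
        ∫ x, G x ∂(wilsonMeasure (d := 3) (L := L) (fundamentalRep (Fin 2)) β')) ^ 2 ∂P ≤
      (4 + 8 * Real.exp 1 * Real.exp (-(1 - 12 * |β'|) * h) / (1 - Real.exp (-(1 - 12 * |β'|) * h))) / N := by
  classical
  haveI : IsProbabilityMeasure (wilsonMeasure (d := 3) (L := L) (fundamentalRep (Fin 2)) β') :=
    isProbabilityMeasure_wilsonMeasure (d := 3) (L := L) (fundamentalRep (Fin 2)) (continuous_fundamentalRep (Fin 2)) β'
  have hlam : 0 < 1 - 12 * |β'| := by linarith
  set m : ℝ := ∫ x, G x ∂(wilsonMeasure (d := 3) (L := L) (fundamentalRep (Fin 2)) β') with hm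
  have hm1 : |m| ≤ 1 := abs_integral_le_of_abs_le_of_isProbabilityMeasure hG1
  have hmU : ∀ u : ℝ≥0, Measurable (U u) := fun u => (hU.adapted u).mono (hW.natFiltration.le u) le_rfl
  -- `(∫ (G − m)² dμ)^{1/2} ≤ 2`
  have hV2 : (∫ x, (G x - m) ^ 2 ∂(wilsonMeasure (d := 3) (L := L) (fundamentalRep (Fin 2)) β')) ^ (1 / (2 : ℝ)) ≤ 2 := by
    have hpt : ∀ x, (G x - m) ^ 2 ≤ 4 := fun x => by
      have h1 : |G x - m| ≤ 2 := (abs_sub _ _).trans (by linarith [hG1 x, hm1])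
      rw [← sq_abs]; nlinarith [abs_nonneg (G x - m)]
    have h4 : ∫ x, (G x - m) ^ 2 ∂(wilsonMeasure (d := 3) (L := L) (fundamentalRep (Fin 2)) β') ≤ 4 := by
      have := integral_mono (integrable_of_abs_le (wilsonMeasure (d := 3) (L := L) (fundamentalRep (Fin 2)) β')
        ((hG.sub measurable_const).pow_const 2) (C := 4) fun x => by rw [abs_of_nonneg (sq_nonneg _)]; exact hpt x)
        (integrable_const (μ := wilsonMeasure (d := 3) (L := L) (fundamentalRep (Fin 2)) β') (4 : ℝ)) hpt
      rwa [integral_const, probReal_univ, one_smul] at this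
    have h := Real.rpow_le_rpow (integral_nonneg fun x => sq_nonneg _) h4 (by norm_num : (0 : ℝ) ≤ 1 / 2)
    have e : (4 : ℝ) ^ (1 / (2 : ℝ)) = 2 := by
      rw [show (4 : ℝ) = 2 ^ (2 : ℝ) by norm_num, ← Real.rpow_mul (by norm_num)]; norm_num
    rw [e] at h; exact h
  -- the centred samples
  set g : ℕ → Ω → ℝ := fun k ω => G (U (2 + t₀ + (k : ℝ≥0) * h) ω) - m with hgdef
  have hgm : ∀ k, Measurable (g k) := fun k => (hG.comp (hmU _)).sub measurable_const
  have hgb : ∀ k ω, |g k ω| ≤ 2 := fun k ω => (abs_sub _ _).trans (by linarith [hG1 (U (2 + t₀ + (k : ℝ≥0) * h) ω), hm1])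
  set r : ℝ := Real.exp (-(1 - 12 * |β'|) * h) with hr
  have hr0 : 0 ≤ r := (Real.exp_pos _).le
  have hr1 : r < 1 := by
    rw [hr, Real.exp_lt_one_iff]
    have : (0 : ℝ) < (1 - 12 * |β'|) * h := mul_pos hlam (by exact_mod_cast hh)
    linarith
  -- two-time decay `|E[g_j g_k]| ≤ 4e·r^(k−j)`
  have hF : Measurable fun x => (G x - m) / 2 := (hG.sub measurable_const).div_const 2
  have hF1 : ∀ x, |(G x - m) / 2| ≤ 1 := fun x => by
    rw [abs_div, abs_two]
    have : |G x - m| ≤ 2 := (abs_sub _ _).trans (by linarith [hG1 x, hm1])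
    linarith
  have hdec : ∀ j k : ℕ, j ≤ k → |∫ ω, g j ω * g k ω ∂P| ≤ 4 * Real.exp 1 * r ^ (k - j) := by
    intro j k hjk
    have ht : 2 + t₀ + (k : ℝ≥0) * h = 2 + t₀ + (j : ℝ≥0) * h + ((k - j : ℕ) : ℝ≥0) * h := by
      rw [add_assoc (2 + t₀), ← add_mul, ← Nat.cast_add, Nat.add_sub_cancel' hjk]
    have h1 := abs_twoTime_centered_le_exp_uniform L β' hβ z hW hU0 hU hF hF1 hG hG1 t₀ ((j : ℝ≥0) * h)
      (((k - j : ℕ) : ℝ≥0) * h) ht₀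
    rw [← ht] at h1
    have heq : ∫ ω, g j ω * g k ω ∂P =
        2 * ∫ ω, (G (U (2 + t₀ + (j : ℝ≥0) * h) ω) - m) / 2 * (G (U (2 + t₀ + (k : ℝ≥0) * h) ω) - m) ∂P := by
      rw [← integral_const_mul]
      exact integral_congr_ae (ae_of_all _ fun ω => by simp only [hgdef]; ring)
    have hpow : Real.exp (-(1 - 12 * |β'|) * ((((k - j : ℕ) : ℝ≥0) * h : ℝ≥0) : ℝ)) = r ^ (k - j) := by
      rw [hr, ← Real.exp_nat_mul]; congr 1; rw [NNReal.coe_mul, NNReal.coe_natCast]; ring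
    rw [heq, abs_mul, abs_two]
    have hrest : 0 ≤ Real.exp 1 * Real.exp (-(1 - 12 * |β'|) * ((((k - j : ℕ) : ℝ≥0) * h : ℝ≥0) : ℝ)) := by positivity
    calc 2 * |∫ ω, (G (U (2 + t₀ + (j : ℝ≥0) * h) ω) - m) / 2 * (G (U (2 + t₀ + (k : ℝ≥0) * h) ω) - m) ∂P|
        ≤ 2 * (Real.exp 1 * Real.exp (-(1 - 12 * |β'|) * ((((k - j : ℕ) : ℝ≥0) * h : ℝ≥0) : ℝ)) *
            (∫ x, (G x - m) ^ 2 ∂(wilsonMeasure (d := 3) (L := L) (fundamentalRep (Fin 2)) β')) ^ (1 / (2 : ℝ))) :=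
          mul_le_mul_of_nonneg_left h1 (by norm_num)
      _ ≤ 2 * (Real.exp 1 * Real.exp (-(1 - 12 * |β'|) * ((((k - j : ℕ) : ℝ≥0) * h : ℝ≥0) : ℝ)) * 2) :=
          mul_le_mul_of_nonneg_left (mul_le_mul_of_nonneg_left hV2 hrest) (by norm_num)
      _ = 4 * Real.exp 1 * r ^ (k - j) := by rw [hpow]; ring
  have hvar := integral_sq_sum_le_of_twoTime hgm hgb (by positivity : (0 : ℝ) ≤ 4 * Real.exp 1) hr0 hr1 hdec N
  -- centring and normalisation
  have hNpos : (0 : ℝ) < (N : ℝ) := by exact_mod_cast hN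
  have hcent : ∀ ω, (N : ℝ)⁻¹ * (∑ k ∈ Finset.range N, G (U (2 + t₀ + (k : ℝ≥0) * h) ω)) - m =
      (N : ℝ)⁻¹ * ∑ k ∈ Finset.range N, g k ω := by
    intro ω
    have hsum : ∑ k ∈ Finset.range N, g k ω = (∑ k ∈ Finset.range N, G (U (2 + t₀ + (k : ℝ≥0) * h) ω)) - N * m := by
      simp only [hgdef, Finset.sum_sub_distrib, Finset.sum_const, Finset.card_range, nsmul_eq_mul]
    rw [hsum, mul_sub, ← mul_assoc, inv_mul_cancel₀ hNpos.ne', one_mul]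
  calc ∫ ω, ((N : ℝ)⁻¹ * (∑ k ∈ Finset.range N, G (U (2 + t₀ + (k : ℝ≥0) * h) ω)) - m) ^ 2 ∂P
      = ∫ ω, ((N : ℝ)⁻¹ * ∑ k ∈ Finset.range N, g k ω) ^ 2 ∂P := integral_congr_ae (ae_of_all _ fun ω => by
          show ((N : ℝ)⁻¹ * (∑ k ∈ Finset.range N, G (U (2 + t₀ + (k : ℝ≥0) * h) ω)) - m) ^ 2 =
            ((N : ℝ)⁻¹ * ∑ k ∈ Finset.range N, g k ω) ^ 2
          rw [hcent ω])
    _ = (N : ℝ)⁻¹ ^ 2 * ∫ ω, (∑ k ∈ Finset.range N, g k ω) ^ 2 ∂P := by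
        rw [← integral_const_mul]; exact integral_congr_ae (ae_of_all _ fun ω => by ring)
    _ ≤ (N : ℝ)⁻¹ ^ 2 * ((N : ℝ) * (2 ^ 2 + 2 * (4 * Real.exp 1) * r / (1 - r))) := mul_le_mul_of_nonneg_left hvar (by positivity)
    _ = (4 + 8 * Real.exp 1 * r / (1 - r)) / N := by field_simp; ring

/-- ★★ **Volume-free deviation bound / sample complexity for discrete samples after the burn-in** (Chebyshev on
`integral_sq_average_sub_wilson_le_uniform`): under the same hypotheses and for every `ε > 0`,
`P[|N⁻¹ Σ_{k<N} G(U_{2+t₀+kh}) − μ_{β'}G| ≥ ε] ≤ (4 + 8e·e^{−λh}/(1 − e^{−λh}))/(N·ε²)`, `λ = 1 − 12|β'|` — so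
`N ≥ (4 + 8e/(e^{λh} − 1))/(δ ε²)` samples after `O(log L)` burn-in sweeps give precision `ε` with confidence `1 − δ`, INDEPENDENTLY of the
volume. [cite: DiaconisSaloffcoste1996, Theorem 3.7] -/
theorem measureReal_average_deviation_le_uniform (L : ℕ) [NeZero L] (β' : ℝ) (hβ : |β'| < 1 / 12)
    (z : GaugeConfig 3 L (Matrix.specialUnitaryGroup (Fin 2) ℂ))
    {Ω : Type} [MeasurableSpace Ω] {P : Measure Ω} [IsProbabilityMeasure P]
    {W : ℝ≥0 → Ω → (Edge 3 L × NoiseIdx 2 → ℝ)} (hW : IsFlatBrownian W P)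
    {U : ℝ≥0 → Ω → GaugeConfig 3 L (Matrix.specialUnitaryGroup (Fin 2) ℂ)} (hU0 : ∀ ω, U 0 ω = z)
    (hU : (latticeLangevinDynamics (fundamentalLatticeRep 2) β').IsSolution (fundamentalRep (Fin 2)) hW.natFiltration P W U)
    {G : GaugeConfig 3 L (Matrix.specialUnitaryGroup (Fin 2) ℂ) → ℝ} (hG : Measurable G) (hG1 : ∀ x, |G x| ≤ 1)
    {h : ℝ≥0} (hh : 0 < h) {N : ℕ} (hN : 1 ≤ N) (t₀ : ℝ≥0)
    (ht₀ : Real.log (96 * |β'| * (Fintype.card (Edge 3 L) : ℝ) + 10 * |β'| * (Fintype.card (Plaquette 3 L) : ℝ) + Real.log 2 +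
      (Fintype.card (Edge 3 L) : ℝ) * Real.log (3 / 2)) ≤ 2 * (1 - 12 * |β'|) * t₀)
    {ε : ℝ} (hε : 0 < ε) :
    P.real {ω | ε ≤ |(N : ℝ)⁻¹ * (∑ k ∈ Finset.range N, G (U (2 + t₀ + (k : ℝ≥0) * h) ω)) -
        ∫ x, G x ∂(wilsonMeasure (d := 3) (L := L) (fundamentalRep (Fin 2)) β')|} ≤
      (4 + 8 * Real.exp 1 * Real.exp (-(1 - 12 * |β'|) * h) / (1 - Real.exp (-(1 - 12 * |β'|) * h))) / (N * ε ^ 2) := by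
  classical
  haveI : IsProbabilityMeasure (wilsonMeasure (d := 3) (L := L) (fundamentalRep (Fin 2)) β') :=
    isProbabilityMeasure_wilsonMeasure (d := 3) (L := L) (fundamentalRep (Fin 2)) (continuous_fundamentalRep (Fin 2)) β'
  set m : ℝ := ∫ x, G x ∂(wilsonMeasure (d := 3) (L := L) (fundamentalRep (Fin 2)) β') with hm
  have hm1 : |m| ≤ 1 := abs_integral_le_of_abs_le_of_isProbabilityMeasure hG1
  have hmain := integral_sq_average_sub_wilson_le_uniform L β' hβ z hW hU0 hU hG hG1 hh hN t₀ ht₀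
  have hmU : ∀ u : ℝ≥0, Measurable (U u) := fun u => (hU.adapted u).mono (hW.natFiltration.le u) le_rfl
  set A : Ω → ℝ := fun ω => (N : ℝ)⁻¹ * (∑ k ∈ Finset.range N, G (U (2 + t₀ + (k : ℝ≥0) * h) ω)) - m with hA
  have hAm : Measurable A :=
    ((Finset.measurable_sum _ fun k _ => hG.comp (hmU _)).const_mul _).sub measurable_const
  -- `|A| ≤ 2`
  have hNpos : (0 : ℝ) < (N : ℝ) := by exact_mod_cast hN
  have hAb : ∀ ω, |A ω| ≤ 2 := by
    intro ω
    have hs : |∑ k ∈ Finset.range N, G (U (2 + t₀ + (k : ℝ≥0) * h) ω)| ≤ N := by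
      calc |∑ k ∈ Finset.range N, G (U (2 + t₀ + (k : ℝ≥0) * h) ω)| ≤ ∑ k ∈ Finset.range N, |G (U (2 + t₀ + (k : ℝ≥0) * h) ω)| :=
            Finset.abs_sum_le_sum_abs _ _
        _ ≤ ∑ k ∈ Finset.range N, (1 : ℝ) := Finset.sum_le_sum fun k _ => hG1 _
        _ = N := by simp
    have h1 : |(N : ℝ)⁻¹ * ∑ k ∈ Finset.range N, G (U (2 + t₀ + (k : ℝ≥0) * h) ω)| ≤ 1 := by
      rw [abs_mul, abs_inv, abs_of_pos hNpos]
      calc (N : ℝ)⁻¹ * |∑ k ∈ Finset.range N, G (U (2 + t₀ + (k : ℝ≥0) * h) ω)| ≤ (N : ℝ)⁻¹ * N :=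
            mul_le_mul_of_nonneg_left hs (inv_nonneg.2 hNpos.le)
        _ = 1 := inv_mul_cancel₀ hNpos.ne'
    exact (abs_sub _ _).trans (by linarith)
  set f : Ω → ℝ := fun ω => A ω ^ 2 with hf
  have hfi : Integrable f P := integrable_of_abs_le P (hAm.pow_const 2) (C := 4) fun ω => by
    rw [hf, abs_pow]; nlinarith [hAb ω, abs_nonneg (A ω)]
  have hmarkov := mul_meas_ge_le_integral_of_nonneg (μ := P) (f := f) (ae_of_all _ fun ω => sq_nonneg _) hfi (ε ^ 2)
  have hsub : {ω | ε ≤ |A ω|} ⊆ {ω | ε ^ 2 ≤ f ω} := by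
    intro ω hω
    simp only [Set.mem_setOf_eq] at hω ⊢
    calc ε ^ 2 ≤ |A ω| ^ 2 := pow_le_pow_left₀ hε.le hω 2
      _ = f ω := sq_abs _
  have hε2 : 0 < ε ^ 2 := by positivity
  calc P.real {ω | ε ≤ |A ω|} ≤ P.real {ω | ε ^ 2 ≤ f ω} := measureReal_mono hsub
    _ ≤ (∫ ω, f ω ∂P) / ε ^ 2 := by rw [le_div_iff₀ hε2, mul_comm]; exact hmarkov
    _ ≤ (4 + 8 * Real.exp 1 * Real.exp (-(1 - 12 * |β'|) * h) / (1 - Real.exp (-(1 - 12 * |β'|) * h))) / N / ε ^ 2 :=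
        div_le_div_of_nonneg_right hmain hε2.le
    _ = _ := by rw [div_div]

end Summit.QuantumFields.YangMills.Theorems.ColdStartUniversality

end
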